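import Summits.Schanuel.Schanuel.Theorems.ZilberEacGraphReciprocalQuadratic
import Summits.Schanuel.Schanuel.Theorems.ZilberEacFibreCurveDensity
import HarnessLib

/-!
# The equimodular class, XXXVI: the reciprocal-type example `{x₁ = c·x₀^d, x₀y₀² + y₀ + x₀ = 0}`

HONEST FRAMING.  Cell `pub-schanuel` (Zilber's Exponential-Algebraic Closedness, case ladder;
host summit Schanuel), seat 2, gen 24.  The fibre polynomial `P = x₀y₀² + y₀ + x₀` is the model
RECIPROCAL-TYPE quadratic fibre (`q₂ = q₀ = x₀`, `q₁ = 1`; the two branches `ρ_±` satisfy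
`ρ_+ρ_- = 1`, so the all-branches trick of THEOREM EB is void).  File XXXV applies: top row
`X² + 1` (simple roots `±i`), `q₂ = x₀` vanishes at `0` where `q₁ = 1` does not, and the discriminant
`1 - 4x₀²` has the simple root `1/2`.  Hence **`unprojectedDensityQuestion_monomialGraph_reciprocalFibre`**:
for all `d ≥ 2`, `c ≠ 0` the surface `{x₁ = c·x₀^d, x₀y₀² + y₀ + x₀ = 0}` is in Mantova–Masser's case
and has Zariski-dense exponential points; **`unprojectedDense_cubicGraph_reciprocalFibre`**:
`{x₁ = x₀³, x₀y₀² + y₀ + x₀ = 0}` — the example named OPEN in the cell's gen-23/24 census (O78 (a)).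
Irreducibility of `P`: degree one in `x₀` over `ℂ[y₀]` with COPRIME coefficients `y₀² + 1`, `y₀`
(`irreducible_C_mul_X_add_C_of_isCoprime`).  An OPEN question in general (PLMS 2024 §1 p. 5);
EC(3,2) OPEN; NOT Schanuel's conjecture (neither used nor implied; EAC ⇏ SC).
-/

noncomputable section

open Complex MvPolynomial
open Literature.NumberTheory.Transcendental Literature.ModelTheory.Zilber
open Literature.ModelTheory.ExponentialFields

set_option linter.dupNamespace false

namespace Summit.Schanuel.Schanuel.Theorems

/-- **A degree-one polynomial with coprime coefficients over a domain is irreducible.** [folklore] -/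
theorem irreducible_C_mul_X_add_C_of_isCoprime {R : Type*} [CommRing R] [IsDomain R] {a b : R}
    (ha : a ≠ 0) (hab : IsCoprime a b) :
    Irreducible (Polynomial.C a * Polynomial.X + Polynomial.C b) := by
  have hdeg : (Polynomial.C a * Polynomial.X + Polynomial.C b).natDegree = 1 :=
    Polynomial.natDegree_linear ha
  have hne : Polynomial.C a * Polynomial.X + Polynomial.C b ≠ 0 := by
    intro h; rw [h, Polynomial.natDegree_zero] at hdeg; exact zero_ne_one hdeg
  refine ⟨fun hu => ?_, fun f g hfg => ?_⟩
  · have := Polynomial.natDegree_eq_zero_of_isUnit hu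
    rw [hdeg] at this; exact one_ne_zero this
  · have hf0 : f ≠ 0 := fun h => hne (by rw [hfg, h, zero_mul])
    have hg0 : g ≠ 0 := fun h => hne (by rw [hfg, h, mul_zero])
    have hsum : f.natDegree + g.natDegree = 1 := by
      rw [← Polynomial.natDegree_mul hf0 hg0, ← hfg, hdeg]
    -- the constant factor divides both coefficients, hence is a unit
    have key : ∀ f g : Polynomial R, Polynomial.C a * Polynomial.X + Polynomial.C b = f * g →
        f.natDegree = 0 → IsUnit f := by
      intro f g hfg hf
      rw [Polynomial.eq_C_of_natDegree_eq_zero hf] at hfg ⊢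
      refine Polynomial.isUnit_C.2 (hab.isUnit_of_dvd' ?_ ?_)
      · have h1 := congrArg (fun q : Polynomial R => q.coeff 1) hfg
        simp only [Polynomial.coeff_add, Polynomial.coeff_C_mul, Polynomial.coeff_X_one, mul_one,
          Polynomial.coeff_C_succ, add_zero] at h1
        exact ⟨g.coeff 1, h1⟩
      · have h0 := congrArg (fun q : Polynomial R => q.coeff 0) hfg
        simp only [Polynomial.coeff_add, Polynomial.coeff_C_mul, Polynomial.coeff_X_zero, mul_zero,
          Polynomial.coeff_C_zero, zero_add] at h0
        exact ⟨g.coeff 0, h0⟩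
    rcases Nat.eq_zero_or_pos f.natDegree with hf | hf
    · exact Or.inl (key f g hfg hf)
    · have hg : g.natDegree = 0 := by omega
      exact Or.inr (key g f (by rw [hfg, mul_comm]) hg)

/-- `x₀y₀² + y₀ + x₀` is irreducible. -/
theorem irreducible_reciprocalFibreP :
    Irreducible (X 0 * X 1 ^ 2 + X 1 + X 0 : MvPolynomial (Fin 2) ℂ) := by
  have himage : MvPolynomial.finSuccEquiv ℂ 1 (X 0 * X 1 ^ 2 + X 1 + X 0) =
      Polynomial.C (X 0 ^ 2 + 1 : MvPolynomial (Fin 1) ℂ) * Polynomial.X +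
        Polynomial.C (X 0 : MvPolynomial (Fin 1) ℂ) := by
    rw [map_add, map_add, map_mul, map_pow, MvPolynomial.finSuccEquiv_X_zero,
      show (X 1 : MvPolynomial (Fin 2) ℂ) = X (Fin.succ 0) from rfl, MvPolynomial.finSuccEquiv_X_succ,
      map_add, map_pow, map_one]
    ring
  have ha : (X 0 ^ 2 + 1 : MvPolynomial (Fin 1) ℂ) ≠ 0 := by
    intro h
    have := congrArg (MvPolynomial.eval fun _ => (0 : ℂ)) h
    simp at this
  have hcop : IsCoprime (X 0 ^ 2 + 1 : MvPolynomial (Fin 1) ℂ) (X 0) := ⟨1, -X 0, by ring⟩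
  have hirr := irreducible_C_mul_X_add_C_of_isCoprime ha hcop
  rw [← himage] at hirr
  exact (MulEquiv.irreducible_iff (MvPolynomial.finSuccEquiv ℂ 1).toMulEquiv).1 hirr

/-- **`{x₁ = c·x₀^d, x₀y₀² + y₀ + x₀ = 0}` is in Mantova–Masser's case and DENSE** for all `d ≥ 2`,
`c ≠ 0` (file XXXV with `q₂ = x₀`, `q₁ = 1`, top row `X² + 1`, `θ = i`, `a = 0`, `e = 1/2`).
[cite: MantovaMasser2023, §1 Further remarks, p. 5 (the question, open in general)] (new) -/
theorem unprojectedDensityQuestion_monomialGraph_reciprocalFibre {c : ℂ} (hc : c ≠ 0) {d : ℕ}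
    (hd : 2 ≤ d) :
    MMCaseDimPiOneFree {w : Fin 2 ⊕ Fin 2 → ℂ |
      w (Sum.inl 1) = c * w (Sum.inl 0) ^ d ∧
        w (Sum.inl 0) * w (Sum.inr 0) ^ 2 + w (Sum.inr 0) + w (Sum.inl 0) = 0} ∧
    UnprojectedDense {w : Fin 2 ⊕ Fin 2 → ℂ |
      w (Sum.inl 1) = c * w (Sum.inl 0) ^ d ∧
        w (Sum.inl 0) * w (Sum.inr 0) ^ 2 + w (Sum.inr 0) + w (Sum.inl 0) = 0} := by
  classical
  set P : MvPolynomial (Fin 2) ℂ := X 0 * X 1 ^ 2 + X 1 + X 0 with hPdef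
  set p : Polynomial ℂ := Polynomial.C c * Polynomial.X ^ d with hpdef
  have hset : {w : Fin 2 ⊕ Fin 2 → ℂ |
      w (Sum.inl 1) = c * w (Sum.inl 0) ^ d ∧
        w (Sum.inl 0) * w (Sum.inr 0) ^ 2 + w (Sum.inr 0) + w (Sum.inl 0) = 0} =
      {w : Fin 2 ⊕ Fin 2 → ℂ | w (Sum.inl 1) = p.eval (w (Sum.inl 0)) ∧
        MvPolynomial.eval ![w (Sum.inl 0), w (Sum.inr 0)] P = 0} := by
    ext w
    simp only [Set.mem_setOf_eq, hpdef, hPdef, Polynomial.eval_mul, Polynomial.eval_C, Polynomial.eval_pow,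
      Polynomial.eval_X, MvPolynomial.eval_X, map_add, map_mul, map_pow,
      Matrix.cons_val_zero, Matrix.cons_val_one]
  rw [hset]
  have hpd : p.natDegree = d := by rw [hpdef, Polynomial.natDegree_C_mul_X_pow d c hc]
  have hd' : 2 ≤ p.natDegree := by rwa [hpd]
  have hirr : Irreducible P := irreducible_reciprocalFibreP
  have hP : ∀ x y : ℂ, MvPolynomial.eval ![x, y] P =
      (Polynomial.X : Polynomial ℂ).eval x * y ^ 2 + (Polynomial.C 1 : Polynomial ℂ).eval x * y +
        1 * (Polynomial.X : Polynomial ℂ).eval x := by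
    intro x y
    simp [hPdef]
  refine ⟨mmCase_fibreCurveSurface p hd' hirr ?_, ?_⟩
  · -- infinitely many `t` with a nonzero fibre point: every `t ≠ 0`
    refine (Set.finite_singleton (0 : ℂ)).infinite_compl.mono ?_
    intro t ht
    simp only [Set.mem_compl_iff, Set.mem_singleton_iff] at ht
    set q : Polynomial ℂ := Polynomial.C t * Polynomial.X ^ 2 + Polynomial.C 1 * Polynomial.X +
      Polynomial.C t with hq
    have hqdeg : 0 < q.degree := by
      rw [hq, Polynomial.degree_quadratic ht]; norm_num
    obtain ⟨y, hy⟩ := Complex.exists_root hqdeg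
    have hy' : t * y ^ 2 + y + t = 0 := by
      have := hy.eq_zero
      simp only [hq, Polynomial.eval_add, Polynomial.eval_mul, Polynomial.eval_C, Polynomial.eval_pow,
        Polynomial.eval_X, one_mul] at this
      exact this
    refine ⟨y, ?_, ?_⟩
    · rintro rfl
      apply ht
      simpa using hy'
    · simp only [hPdef, map_add, map_mul, map_pow, MvPolynomial.eval_X, Matrix.cons_val_zero,
        Matrix.cons_val_one]
      exact hy'
  · have hTeq : (Polynomial.C ((Polynomial.X : Polynomial ℂ).coeff 1) * Polynomial.X ^ 2 +
        Polynomial.C ((Polynomial.C (1 : ℂ)).coeff 1) * Polynomial.X +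
        Polynomial.C (1 * (Polynomial.X : Polynomial ℂ).coeff 1) : Polynomial ℂ) = Polynomial.X ^ 2 + 1 := by
      simp [Polynomial.coeff_one]
    refine unprojectedDense_graph_reciprocalQuadratic (Polynomial.C 1) Polynomial.X 1 hP hirr 1
      Polynomial.natDegree_X_le (by simp) _ rfl ?_ (θ := I) I_ne_zero ?_ ?_ (a := 0) (e := 1 / 2)
      Polynomial.X_ne_zero (by simp) (odd_rootMultiplicity_of_simple_root ?_ ?_) p hd'
    · rw [hTeq]
      intro h
      have := congrArg (fun q : Polynomial ℂ => q.eval 0) h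
      simp at this
    · rw [hTeq]; simp
    · rw [hTeq]
      simp
    · simp only [Polynomial.IsRoot, one_pow, map_mul, Polynomial.eval_sub, Polynomial.eval_pow,
        Polynomial.eval_C, Polynomial.eval_mul, Polynomial.eval_X]
      norm_num
    · intro h
      simp [Polynomial.derivative_mul] at h

/-- **`{x₁ = x₀³, x₀y₀² + y₀ + x₀ = 0}` has Zariski-dense exponential points** — the reciprocal-type
member left open by THEOREM EB, decided by the transcendence of the logarithm of a quadratic branch.
[cite: MantovaMasser2023, §1 Further remarks, p. 5 (the question, open in general)] (new) -/
theorem unprojectedDense_cubicGraph_reciprocalFibre :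
    UnprojectedDense {w : Fin 2 ⊕ Fin 2 → ℂ |
      w (Sum.inl 1) = w (Sum.inl 0) ^ 3 ∧ w (Sum.inl 0) * w (Sum.inr 0) ^ 2 + w (Sum.inr 0) + w (Sum.inl 0) = 0} := by
  have h := (unprojectedDensityQuestion_monomialGraph_reciprocalFibre one_ne_zero (by norm_num : 2 ≤ 3)).2
  simpa only [one_mul] using h

/-- **The RESONANT reciprocal member `{x₁ = (i/4π)·x₀², x₀y₀² + y₀ + x₀ = 0}` has Zariski-dense
exponential points.**  Along the branch through `θ = -i` (`τ = -iπ/2`) the phase polynomial is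
`P̃(τ + 2πik) = (i/4π)(i(2πk - π/2))²`, whose real part vanishes identically and whose imaginary part
`/2π` is `-k²/2 + k/4 - 1/32 ∈ ℚ[k]`: no growth, periodic phases — the regime where density rests on
THEOREM T and hence on the transcendence of the logarithm of the quadratic branch (file XXXIV).
(For the cubic base above, `Re x₀³` happens to grow linearly along the labels as well.)
[cite: MantovaMasser2023, §1 Further remarks, p. 5 (the question, open in general)] (new) -/
theorem unprojectedDense_resonantParabola_reciprocalFibre :
    UnprojectedDense {w : Fin 2 ⊕ Fin 2 → ℂ |
      w (Sum.inl 1) = I / (4 * Real.pi) * w (Sum.inl 0) ^ 2 ∧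
        w (Sum.inl 0) * w (Sum.inr 0) ^ 2 + w (Sum.inr 0) + w (Sum.inl 0) = 0} :=
  (unprojectedDensityQuestion_monomialGraph_reciprocalFibre
    (div_ne_zero I_ne_zero (mul_ne_zero (by norm_num) (by exact_mod_cast Real.pi_ne_zero)))
    (le_refl 2)).2

end Summit.Schanuel.Schanuel.Theorems
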